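import Literature.AlgebraicGeometry.Hu2025.Proofs.S03Pluecker.GammaQuadPlane
import Mathlib.RingTheory.Localization.Away.Basic
import Mathlib.RingTheory.Localization.Integral
import Mathlib.RingTheory.MvPolynomial.Basic
import HarnessLib

/-!
# Hu 2025 — the THIN SCHUBERT CELL of the complete quadrilateral is integral, part 1: the parametrisation ring
# (joint J1 / GAP-LEDGER-HU row HU-R01 — kernel support, OURS)

**HONEST FRAMING (D-0012/D-0089).** [Hu2025] is an unrefereed preprint under adjudication; nothing of it is asserted. OURS objects only.
The open locus `Z_Γ ∩ {x̄_u invertible, u ∉ Γ}` of the typed Γ-scheme of the complete quadrilateral (`Γ = {456, 478, 579, 689}`, rows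
101/109) is the matroid Schubert cell `Gr^{3,E}_d` of the realised family `d` of `Proofs/S01S09Interface/GammaQuadHuMatroid.lean` met with
the chart `𝕌`. This file sets up an explicit PARAMETRISATION of that cell: a basis `B = (a₄, a₅, a₇)` (9 free entries), `a₆ = p₆a₄ + q₆a₅`,
`a₈ = p₈a₄ + r₈a₇`, `a₉ ∝ −q₆p₈r₉·a₅ + p₆r₈r₉·a₇` (the fourth collinearity `det(a₆,a₈,a₉) = 0` solved for the `a₅`-coordinate of `a₉`),
the polynomial ring `P = k[14 parameters]`, the columns `colP`, the minors `minorP`, and the localisation `S = P[1/D₀]` at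
`D₀ = p₆ r₈ · ∏_{u ∉ Γ} minorP u`, which is a DOMAIN (`k` a field of characteristic `0`: `D₀ ≠ 0` is certified by evaluation at the
rational parameters of the certificate point `Q`). Part 2 (`GammaQuadCellDomain.lean`) maps the localised Γ-scheme ring into `S` with a
retraction, proving it is a domain. AI proof is weaker than expert review.
-/

noncomputable section

namespace Literature.AlgebraicGeometry.Hu2025.Statements.S03Pluecker

open MvPolynomial Matrix

namespace QuadCell

variable (k : Type) [Field k]

/-- `det` of three vectors taken as ROWS (the convention of row 101b's `chartMinor`). OURS plumbing.
[cite: Hu2025, Prop. 9.1 (Gr_d) p.160 / Def. 7.1 (Z_Γ) p.128; joint J1 = GAP-LEDGER-HU row HU-R01 (unrefereed preprint arXiv:2507.21400v1 under adjudication, D-0012/D-0089 — kernel support on OUR typed carriers of rows 101/110; nothing of the source asserted)] -/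
abbrev det3 {R : Type*} [CommRing R] (v w x : Fin 3 → R) : R := Matrix.det (Matrix.of ![v, w, x])

variable {k}

/-- Cofactor expansion of `det3`.
[cite: Hu2025, Prop. 9.1 (Gr_d) p.160 / Def. 7.1 (Z_Γ) p.128; joint J1 = GAP-LEDGER-HU row HU-R01 (unrefereed preprint arXiv:2507.21400v1 under adjudication, D-0012/D-0089 — kernel support on OUR typed carriers of rows 101/110; nothing of the source asserted)] -/
theorem det3_eq {R : Type*} [CommRing R] (v w x : Fin 3 → R) :
    det3 v w x = v 0 * (w 1 * x 2 - w 2 * x 1) - v 1 * (w 0 * x 2 - w 2 * x 0) + v 2 * (w 0 * x 1 - w 1 * x 0) := by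
  simp [det3, Matrix.det_fin_three]
  ring

/-- **Cramer**: `det(v,w,x) • y = det(y,w,x) • v + det(v,y,x) • w + det(v,w,y) • x`.
[cite: Hu2025, Prop. 9.1 (Gr_d) p.160 / Def. 7.1 (Z_Γ) p.128; joint J1 = GAP-LEDGER-HU row HU-R01 (unrefereed preprint arXiv:2507.21400v1 under adjudication, D-0012/D-0089 — kernel support on OUR typed carriers of rows 101/110; nothing of the source asserted)] -/
theorem cramer3 {R : Type*} [CommRing R] (v w x y : Fin 3 → R) :
    det3 v w x • y = det3 y w x • v + det3 v y x • w + det3 v w y • x := by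
  funext i
  simp only [Pi.smul_apply, Pi.add_apply, smul_eq_mul, det3_eq]
  fin_cases i <;> simp <;> ring

/-- `det3` is linear in the last slot.
[cite: Hu2025, Prop. 9.1 (Gr_d) p.160 / Def. 7.1 (Z_Γ) p.128; joint J1 = GAP-LEDGER-HU row HU-R01 (unrefereed preprint arXiv:2507.21400v1 under adjudication, D-0012/D-0089 — kernel support on OUR typed carriers of rows 101/110; nothing of the source asserted)] -/
theorem det3_add_smul {R : Type*} [CommRing R] (v w x y : Fin 3 → R) (p q : R) :
    det3 v w (p • x + q • y) = p * det3 v w x + q * det3 v w y := by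
  simp only [det3_eq, Pi.add_apply, Pi.smul_apply, smul_eq_mul]
  ring

/-- Images of `det3` under ring homomorphisms.
[cite: Hu2025, Prop. 9.1 (Gr_d) p.160 / Def. 7.1 (Z_Γ) p.128; joint J1 = GAP-LEDGER-HU row HU-R01 (unrefereed preprint arXiv:2507.21400v1 under adjudication, D-0012/D-0089 — kernel support on OUR typed carriers of rows 101/110; nothing of the source asserted)] -/
theorem map_det3 {R T : Type*} [CommRing R] [CommRing T] (f : R →+* T) (v w x : Fin 3 → R) :
    f (det3 v w x) = det3 (f ∘ v) (f ∘ w) (f ∘ x) := by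
  simp only [det3_eq, map_add, map_sub, map_mul, Function.comp_apply]

/-! ## The parameter ring `P = k[X₀, …, X₁₃]` and the parametrised columns -/

/-- `P = k[14 parameters]`: `X₀..X₂ = a₄`, `X₃..X₅ = a₅`, `X₆..X₈ = a₇`, `X₉ = p₆`, `X₁₀ = q₆`, `X₁₁ = p₈`, `X₁₂ = r₈`, `X₁₃ = r₉`. OURS.
[cite: Hu2025, Prop. 9.1 (Gr_d) p.160 / Def. 7.1 (Z_Γ) p.128; joint J1 = GAP-LEDGER-HU row HU-R01 (unrefereed preprint arXiv:2507.21400v1 under adjudication, D-0012/D-0089 — kernel support on OUR typed carriers of rows 101/110; nothing of the source asserted)] -/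
abbrev P (k : Type) [Field k] : Type := MvPolynomial (Fin 14) k

/-- the basis columns `a₄, a₅, a₇` (free parameters).
[cite: Hu2025, Prop. 9.1 (Gr_d) p.160 / Def. 7.1 (Z_Γ) p.128; joint J1 = GAP-LEDGER-HU row HU-R01 (unrefereed preprint arXiv:2507.21400v1 under adjudication, D-0012/D-0089 — kernel support on OUR typed carriers of rows 101/110; nothing of the source asserted)] -/
def b4 : Fin 3 → P k := ![X 0, X 1, X 2]
/-- the basis column `a₅`.
[cite: Hu2025, Prop. 9.1 (Gr_d) p.160 / Def. 7.1 (Z_Γ) p.128; joint J1 = GAP-LEDGER-HU row HU-R01 (unrefereed preprint arXiv:2507.21400v1 under adjudication, D-0012/D-0089 — kernel support on OUR typed carriers of rows 101/110; nothing of the source asserted)] -/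
def b5 : Fin 3 → P k := ![X 3, X 4, X 5]
/-- the basis column `a₇`.
[cite: Hu2025, Prop. 9.1 (Gr_d) p.160 / Def. 7.1 (Z_Γ) p.128; joint J1 = GAP-LEDGER-HU row HU-R01 (unrefereed preprint arXiv:2507.21400v1 under adjudication, D-0012/D-0089 — kernel support on OUR typed carriers of rows 101/110; nothing of the source asserted)] -/
def b7 : Fin 3 → P k := ![X 6, X 7, X 8]

/-- **The parametrised columns** `colP a`, `a = 1, …, 9`: the frame, `a₄, a₅, a₇` free, `a₆ = p₆a₄ + q₆a₅`, `a₈ = p₈a₄ + r₈a₇`, and the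
SCALED ninth column `a₉' = (−q₆p₈r₉)·a₅ + (p₆r₈r₉)·a₇` (`= p₆r₈ · a₉`). OURS.
[cite: Hu2025, Prop. 9.1 (Gr_d) p.160 / Def. 7.1 (Z_Γ) p.128; joint J1 = GAP-LEDGER-HU row HU-R01 (unrefereed preprint arXiv:2507.21400v1 under adjudication, D-0012/D-0089 — kernel support on OUR typed carriers of rows 101/110; nothing of the source asserted)] -/
def colP (a : ℕ) : Fin 3 → P k :=
  if a = 1 then ![1, 0, 0] else if a = 2 then ![0, 1, 0] else if a = 3 then ![0, 0, 1]
  else if a = 4 then b4 else if a = 5 then b5 else if a = 7 then b7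
  else if a = 6 then (X 9 : P k) • b4 + (X 10 : P k) • b5
  else if a = 8 then (X 11 : P k) • b4 + (X 12 : P k) • b7
  else if a = 9 then (-(X 10 * X 11 * X 13) : P k) • b5 + (X 9 * X 12 * X 13 : P k) • b7
  else 0

/-- **The `u`-minor of the parametrised matrix** (rows = the columns `colP u₁, colP u₂, colP u₃`). OURS.
[cite: Hu2025, Prop. 9.1 (Gr_d) p.160 / Def. 7.1 (Z_Γ) p.128; joint J1 = GAP-LEDGER-HU row HU-R01 (unrefereed preprint arXiv:2507.21400v1 under adjudication, D-0012/D-0089 — kernel support on OUR typed carriers of rows 101/110; nothing of the source asserted)] -/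
def minorP (u : ℕ × ℕ × ℕ) : P k := det3 (colP u.1) (colP u.2.1) (colP u.2.2)

/-- The parametrised columns, by name (numeral bookkeeping).
[cite: Hu2025, Prop. 9.1 (Gr_d) p.160 / Def. 7.1 (Z_Γ) p.128; joint J1 = GAP-LEDGER-HU row HU-R01 (unrefereed preprint arXiv:2507.21400v1 under adjudication, D-0012/D-0089 — kernel support on OUR typed carriers of rows 101/110; nothing of the source asserted)] -/
theorem colP_val :
    colP (k := k) 1 = ![1, 0, 0] ∧ colP (k := k) 2 = ![0, 1, 0] ∧ colP (k := k) 3 = ![0, 0, 1] ∧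
    colP (k := k) 4 = b4 ∧ colP (k := k) 5 = b5 ∧ colP (k := k) 7 = b7 ∧
    colP (k := k) 6 = (X 9 : P k) • b4 + (X 10 : P k) • b5 ∧
    colP (k := k) 8 = (X 11 : P k) • b4 + (X 12 : P k) • b7 ∧
    colP (k := k) 9 = (-(X 10 * X 11 * X 13) : P k) • b5 + (X 9 * X 12 * X 13 : P k) • b7 := by
  simp [colP]

/-- **The four quadrilateral minors of the parametrised matrix vanish** (three by construction of `a₆, a₈`; the fourth because
`a₉'` solves `det(a₆,a₈,a₉) = 0`).
[cite: Hu2025, Prop. 9.1 (Gr_d) p.160 / Def. 7.1 (Z_Γ) p.128; joint J1 = GAP-LEDGER-HU row HU-R01 (unrefereed preprint arXiv:2507.21400v1 under adjudication, D-0012/D-0089 — kernel support on OUR typed carriers of rows 101/110; nothing of the source asserted)] -/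
theorem minorP_gamma : ∀ u ∈ quadGamma, minorP (k := k) u = 0 := by
  obtain ⟨c1, c2, c3, c4, c5, c7, c6, c8, c9⟩ := colP_val (k := k)
  intro u hu
  simp only [quadGamma, Set.mem_insert_iff, Set.mem_singleton_iff] at hu
  rcases hu with rfl | rfl | rfl | rfl <;>
  · simp only [minorP, c4, c5, c6, c7, c8, c9, det3_eq, b4, b5, b7, Pi.add_apply, Pi.smul_apply, smul_eq_mul,
      Matrix.cons_val_zero, Matrix.cons_val_one, Matrix.cons_val_two, Matrix.head_cons, Matrix.tail_cons]
    ring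

/-- **The chart indices off `Γ`** as a `Finset`.
[cite: Hu2025, Prop. 9.1 (Gr_d) p.160 / Def. 7.1 (Z_Γ) p.128; joint J1 = GAP-LEDGER-HU row HU-R01 (unrefereed preprint arXiv:2507.21400v1 under adjudication, D-0012/D-0089 — kernel support on OUR typed carriers of rows 101/110; nothing of the source asserted)] -/
def offGamma : Finset (ℕ × ℕ × ℕ) := (plVarSet 9).filter fun u => u ∉ quadGammaFin

/-- **`D₀ = p₆ · r₈ · ∏_{u ∈ 𝕀_{3,9} ∖ m, u ∉ Γ} minorP u`** — the element inverted in the parametrisation ring. OURS.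
[cite: Hu2025, Prop. 9.1 (Gr_d) p.160 / Def. 7.1 (Z_Γ) p.128; joint J1 = GAP-LEDGER-HU row HU-R01 (unrefereed preprint arXiv:2507.21400v1 under adjudication, D-0012/D-0089 — kernel support on OUR typed carriers of rows 101/110; nothing of the source asserted)] -/
def D0 : P k := X 9 * X 12 * ∏ u ∈ offGamma, minorP u

/-- **The parametrisation ring `S = P[1/D₀]`**. OURS.
[cite: Hu2025, Prop. 9.1 (Gr_d) p.160 / Def. 7.1 (Z_Γ) p.128; joint J1 = GAP-LEDGER-HU row HU-R01 (unrefereed preprint arXiv:2507.21400v1 under adjudication, D-0012/D-0089 — kernel support on OUR typed carriers of rows 101/110; nothing of the source asserted)] -/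
abbrev S (k : Type) [Field k] : Type := Localization.Away (D0 (k := k))

/-! ## `D₀ ≠ 0` in characteristic `0`: evaluation at the rational parameters of the certificate point `Q` -/

/-- **The rational parameters of `Q`**: `a₄ = (1,−4,−3)`, `a₅ = (1,4,5)`, `a₇ = (5,4,1)`, `p₆ = 1/8`, `q₆ = 7/8`, `p₈ = −3/8`, `r₈ = 7/8`,
`r₉ = 1/8` (so that `a₆ = (1,3,4)`, `a₈ = (4,5,2)` and `a₉' = (7/64)·(1,2,2)`). OURS.
[cite: Hu2025, Prop. 9.1 (Gr_d) p.160 / Def. 7.1 (Z_Γ) p.128; joint J1 = GAP-LEDGER-HU row HU-R01 (unrefereed preprint arXiv:2507.21400v1 under adjudication, D-0012/D-0089 — kernel support on OUR typed carriers of rows 101/110; nothing of the source asserted)] -/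
def ptN (i : ℕ) : k :=
  if i = 0 then 1 else if i = 1 then -4 else if i = 2 then -3
  else if i = 3 then 1 else if i = 4 then 4 else if i = 5 then 5
  else if i = 6 then 5 else if i = 7 then 4 else if i = 8 then 1
  else if i = 9 then 1/8 else if i = 10 then 7/8 else if i = 11 then -3/8
  else if i = 12 then 7/8 else 1/8

/-- `pt i = ptN i` on `Fin 14` (the rational parameters of `Q`).
[cite: Hu2025, Prop. 9.1 (Gr_d) p.160 / Def. 7.1 (Z_Γ) p.128; joint J1 = GAP-LEDGER-HU row HU-R01 (unrefereed preprint arXiv:2507.21400v1 under adjudication, D-0012/D-0089 — kernel support on OUR typed carriers of rows 101/110; nothing of the source asserted)] -/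
def pt : Fin 14 → k := fun i => ptN i.val

/-- At `pt`, the parametrised column `a` is the column of `Q` (`colZ Q a`, cast), except `a = 9` which is scaled by `7/64`.
[cite: Hu2025, Prop. 9.1 (Gr_d) p.160 / Def. 7.1 (Z_Γ) p.128; joint J1 = GAP-LEDGER-HU row HU-R01 (unrefereed preprint arXiv:2507.21400v1 under adjudication, D-0012/D-0089 — kernel support on OUR typed carriers of rows 101/110; nothing of the source asserted)] -/
theorem eval_pt_colP [CharZero k] {a : ℕ} (ha1 : 1 ≤ a) (ha9 : a ≤ 9) (i : Fin 3) :
    MvPolynomial.eval pt (colP (k := k) a i) =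
      (if a = 9 then (7/64 : k) else 1) * (colZ quadPointQexact a i : k) := by
  obtain ⟨c1, c2, c3, c4, c5, c7, c6, c8, c9⟩ := colP_val (k := k)
  have ha : a = 1 ∨ a = 2 ∨ a = 3 ∨ a = 4 ∨ a = 5 ∨ a = 6 ∨ a = 7 ∨ a = 8 ∨ a = 9 := by omega
  rcases ha with rfl | rfl | rfl | rfl | rfl | rfl | rfl | rfl | rfl <;> fin_cases i <;>
    norm_num [c1, c2, c3, c4, c5, c6, c7, c8, c9, colZ, b4, b5, b7, pt, ptN, quadPointQexact,
      Matrix.cons_val_zero, Matrix.cons_val_one, Matrix.cons_val_two, Matrix.head_cons, Matrix.tail_cons]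

/-- At `pt`, `minorP u` is `(7/64)^{[9 ∈ u]} · minorZ Q u` for chart indices `u`.
[cite: Hu2025, Prop. 9.1 (Gr_d) p.160 / Def. 7.1 (Z_Γ) p.128; joint J1 = GAP-LEDGER-HU row HU-R01 (unrefereed preprint arXiv:2507.21400v1 under adjudication, D-0012/D-0089 — kernel support on OUR typed carriers of rows 101/110; nothing of the source asserted)] -/
theorem eval_pt_minorP [CharZero k] {u : ℕ × ℕ × ℕ} (hu : u ∈ plVarSet 9) :
    MvPolynomial.eval pt (minorP (k := k) u) =
      (if u.2.2 = 9 then (7/64 : k) else 1) * (minorZ quadPointQexact u : k) := by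
  have hidx := mem_plIndexSet_iff.mp (Finset.mem_erase.mp hu).2
  rw [minorZ_eq_det quadPointQexact hu, minorP, map_det3]
  have h1 : u.1 ≠ 9 := by omega
  have h2 : u.2.1 ≠ 9 := by omega
  have e1 : (MvPolynomial.eval pt) ∘ colP (k := k) u.1 = fun i => (colZ quadPointQexact u.1 i : k) := by
    funext i; rw [Function.comp_apply, eval_pt_colP (by omega) (by omega), if_neg h1, one_mul]
  have e2 : (MvPolynomial.eval pt) ∘ colP (k := k) u.2.1 = fun i => (colZ quadPointQexact u.2.1 i : k) := by
    funext i; rw [Function.comp_apply, eval_pt_colP (by omega) (by omega), if_neg h2, one_mul]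
  have e3 : (MvPolynomial.eval pt) ∘ colP (k := k) u.2.2 =
      fun i => (if u.2.2 = 9 then (7/64 : k) else 1) * (colZ quadPointQexact u.2.2 i : k) := by
    funext i; rw [Function.comp_apply, eval_pt_colP (by omega) (by omega)]
  rw [e1, e2, e3]
  -- both sides are explicit determinants
  rw [colMatZ, Matrix.det_fin_three]
  simp only [det3_eq, Matrix.of_apply, Matrix.cons_val_zero, Matrix.cons_val_one, Matrix.head_cons,
    Matrix.cons_val_two, Matrix.tail_cons, Int.cast_sub, Int.cast_add, Int.cast_mul]
  ring

/-- **`D₀(pt) ≠ 0`** (`k` of characteristic `0`): every non-`Γ` minor of `Q` is a non-zero integer.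
[cite: Hu2025, Prop. 9.1 (Gr_d) p.160 / Def. 7.1 (Z_Γ) p.128; joint J1 = GAP-LEDGER-HU row HU-R01 (unrefereed preprint arXiv:2507.21400v1 under adjudication, D-0012/D-0089 — kernel support on OUR typed carriers of rows 101/110; nothing of the source asserted)] -/
theorem eval_pt_D0_ne_zero [CharZero k] : MvPolynomial.eval pt (D0 (k := k)) ≠ 0 := by
  rw [D0, map_mul, map_mul, map_prod]
  refine mul_ne_zero (mul_ne_zero ?_ ?_) ?_
  · norm_num [pt, ptN]
  · norm_num [pt, ptN]
  · rw [Finset.prod_ne_zero_iff]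
    intro u hu
    have hu' : u ∈ plVarSet 9 := (Finset.mem_filter.mp hu).1
    have hΓ : u ∉ quadGammaFin := (Finset.mem_filter.mp hu).2
    rw [eval_pt_minorP hu']
    refine mul_ne_zero ?_ ?_
    · split_ifs <;> norm_num
    · rw [Int.cast_ne_zero]
      exact fun h0 => hΓ ((minorZ_quadPointQexact_eq_zero_iff u hu').mp h0)

/-- **`D₀ ≠ 0`** in `P = k[X₀..X₁₃]` (`k` of characteristic `0`).
[cite: Hu2025, Prop. 9.1 (Gr_d) p.160 / Def. 7.1 (Z_Γ) p.128; joint J1 = GAP-LEDGER-HU row HU-R01 (unrefereed preprint arXiv:2507.21400v1 under adjudication, D-0012/D-0089 — kernel support on OUR typed carriers of rows 101/110; nothing of the source asserted)] -/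
theorem D0_ne_zero [CharZero k] : D0 (k := k) ≠ 0 := fun h =>
  eval_pt_D0_ne_zero (k := k) (by rw [h, map_zero])

/-- **The parametrisation ring `S = k[X₀..X₁₃][1/D₀]` is a domain** (`k` of characteristic `0`).
[cite: Hu2025, Prop. 9.1 (Gr_d) p.160 / Def. 7.1 (Z_Γ) p.128; joint J1 = GAP-LEDGER-HU row HU-R01 (unrefereed preprint arXiv:2507.21400v1 under adjudication, D-0012/D-0089 — kernel support on OUR typed carriers of rows 101/110; nothing of the source asserted)] -/
theorem isDomain_S [CharZero k] : IsDomain (S k) :=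
  IsLocalization.isDomain_of_le_nonZeroDivisors (M := Submonoid.powers (D0 (k := k))) _
    (powers_le_nonZeroDivisors_of_noZeroDivisors D0_ne_zero)

end QuadCell

end Literature.AlgebraicGeometry.Hu2025.Statements.S03Pluecker

end
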